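import Literature.AlgebraicGeometry.Frobenioids.PadicFrobenioidMonogenicSplit
import Literature.AlgebraicGeometry.Frobenioids.PadicFrobenioidInclusion
import HarnessLib

/-!
# Frobenioids II, Example 1.1 (ii) ⇝ [IUTchI] Example 3.2 (iv)–(v): the L1-side export `(C_v^⊢, τ_v^⊢)` at a bad place

Mochizuki, *The geometry of Frobenioids II*, Kyushu J. Math. **62** (2008) 401–460, §1, Example 1.1 (ii), p. 8
[cite: MochizukiFrdII2008, Ex 1.1 (ii) p.8]; consumed by [IUTchI] Ex. 3.2 (iv)–(v): "the image of `q_v` determines a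
constant section [i.e., a sub-monoid on `D_v` isomorphic to `ℕ`] `log_Φ(q_v)` of `Φ_{C_v}`", "`Φ_{C_v^⊢} := ℕ · log_Φ(q_v)|_{D_v^⊢}`
… determines a `p_v`-adic Frobenioid with base category given by `D_v^⊢` [cf. [FrdII], Example 1.1, (ii)]", "`q_v`
determines a `μ_{2l}(−)`-orbit of characteristic splittings `τ_v^⊢`".

abc-iut-L1-lead R52 (5a) "bad variant" (abc-iut-L5-t2 YES 23:43Z): the export over a **`K_v`-RELATIVE base** — a base
functor `base : D ⥤ PadicFld p` together with a compatible family of valuative embeddings `emb_A : K_v → K_A`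
(`RelEmb`; this is what fixed fields inside an algebraic closure of `K_v` carry) — of the monogenic datum of
`PadicFrobenioidMonogenic.lean` generated by the constant section "image of `q′`" for a non-unit `q′ ∈ O_{K_v}^⊳`:

* `RelEmb.img q′`, `RelEmb.isConstantSection` — the images of `q′` form a constant section (PROVED);
* `BadLocalKit.datum / Cdash / CdashBase / logq / logq_generates / isMonoidData` — `C_v^⊢` with `Φ = ℕ · log(q′)`;
* **`BadLocalKit.tauDashOf q″ (h : Associated q″ q′)`** — the characteristic splitting on `C_v^⊢(q′)` determined by any
  associate `q″` of `q′` (e.g. another `2l`-th root of `q_v`: the `μ_{2l}`-ORBIT clause), via `Datum.cSplitting`;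
  `BadLocalKit.tauDash := tauDashOf q′`;
* `BadLocalKit.monogenicSubDatum` (`= datum` by `rfl`), `CdashToPerf` — `C_v^⊢ →` the `p_v`-adic Frobenioid of the
  perfection over the same base (faithful), for consumers wanting the `p_v`-adic hull rather than the tempered `F̲_v`.
-/

noncomputable section

namespace Literature.AlgebraicGeometry.Frobenioids

namespace PadicFrd

open CategoryTheory Opposite Function ValuativeRel

universe v u

variable {D : Type u} [Category.{v} D] {p : ℕ} (base : D ⥤ PadicFld.{u} p) (Kv : Type u) [Field Kv] [ValuativeRel Kv]

/-- A **`K_v`-relative structure** on a base of `p`-adic fields: valuative embeddings `emb_A : K_v → K_A` compatible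
with the restriction maps (`σ_f ∘ emb_{A'} = emb_A`). [cite: MochizukiFrdII2008, Ex 1.1 (ii) p.8] -/
structure RelEmb where
  /-- the embedding `K_v → K_A` -/
  emb : ∀ A : D, Kv →+* (base.obj A).K
  /-- each embedding is valuative -/
  isValHom : ∀ A : D, IsValHom (emb A)
  /-- compatibility with the arrows of the base -/
  comp : ∀ {A A' : D} (f : A ⟶ A'), ((base.map f).alg : (base.obj A').K →+* (base.obj A).K).comp (emb A') = emb A

namespace RelEmb

variable {base Kv} (E : RelEmb base Kv)

/-- The section `A ↦ emb_A(q′) ∈ O_{K_A}^⊳` of an element `q′ ∈ O_{K_v}^⊳` ("the image of `q_v`").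
[cite: MochizukiFrdII2008, Ex 1.1 (ii) p.8] -/
def img (q' : intNonzero Kv) (A : D) : intNonzero (base.obj A).K := intNonzeroMapOfHom (E.emb A) (E.isValHom A) q'

/-- Its value. [cite: MochizukiFrdII2008, Ex 1.1 (ii) p.8] -/
@[simp] theorem coe_img (q' : intNonzero Kv) (A : D) : (E.img q' A : (base.obj A).K) = E.emb A q' := rfl

/-- The class of the image of a non-unit is not a unit (`ord(O_{K_v}^⊳) → ord(O_{K_A}^⊳)` is injective,
abc-iut-L1-d8's `ordIntMapOfHom_injective`). [cite: MochizukiFrdII2008, Ex 1.1 (ii) p.8] -/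
theorem not_isUnit_img {q' : intNonzero Kv} (hq' : ¬ IsUnit q') (A : D) : ¬ IsUnit (E.img q' A) := by
  intro h
  apply hq'
  rw [← Associates.mk_eq_one] at h ⊢
  apply ordIntMapOfHom_injective (E.emb A) (E.isValHom A)
  rw [ordIntMapOfHom_mk, map_one]
  exact h

/-- **The images of a non-unit `q′ ∈ O_{K_v}^⊳` form a constant section** ("the image of `q_v` determines a constant
section", [IUTchI] Ex. 3.2 (iv)). [cite: MochizukiFrdII2008, Ex 1.1 (ii) p.8] -/
theorem isConstantSection {q' : intNonzero Kv} (hq' : ¬ IsUnit q') : Monogenic.IsConstantSection base (E.img q') where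
  map_eq f := Subtype.ext (by
    change (base.map f).alg (E.emb _ q') = E.emb _ q'
    rw [← RingHom.comp_apply, E.comp f])
  not_isUnit A := E.not_isUnit_img hq' A

/-- Associates `q″ ~ q′` have sections with the same classes in `ord(O_{K_A}^⊳)`. [cite: MochizukiFrdII2008, Ex 1.1 (ii) p.8] -/
theorem associatesMk_img_eq {q'' q' : intNonzero Kv} (h : Associated q'' q') (A : D) :
    Associates.mk (E.img q'' A) = Associates.mk (E.img q' A) := by
  change ordIntMapOfHom (E.emb A) (E.isValHom A) (Associates.mk q'') = ordIntMapOfHom (E.emb A) (E.isValHom A) (Associates.mk q')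
  rw [Associates.mk_eq_mk_iff_associated.mpr h]

end RelEmb

/-! ### The export -/

namespace BadLocalKit

variable {base Kv} [Fact p.Prime] (E : RelEmb base Kv) (hloc : ∀ A : D, (base.obj A).IsPadicLocal)
  (hc : IsConnected D) (he : IsTotallyEpimorphic D) {q' : intNonzero Kv} (hq' : ¬ IsUnit q')

/-- **The datum of `C_v^⊢` at a bad place**: the monogenic `p_v`-adic Frobenioid datum generated by the constant section
"image of `q′`" (`Φ = ℕ · log(q′)`). [cite: MochizukiFrdII2008, Ex 1.1 (ii) p.8] -/
abbrev datum : Datum D p := Datum.monogenic base (E.isConstantSection hq') hloc hc he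

/-- `C_v^⊢` ("a `p_v`-adic Frobenioid with base category given by `D_v^⊢`"). [cite: MochizukiFrdII2008, Ex 1.1 (ii) p.8] -/
abbrev Cdash : Type u := (datum E hloc hc he hq').frobenioid

/-- `C_v^⊢ → D_v^⊢`. [cite: MochizukiFrdII2008, Ex 1.1 (ii) p.8] -/
abbrev CdashBase : Cdash E hloc hc he hq' ⥤ D := ModelFrobenioid.baseFunctor _ _ (datum E hloc hc he hq').divB

/-- `log(q′)`, the generator of `Φ_{C_v^⊢}(A) = ℕ · log(q′)`. [cite: MochizukiFrdII2008, Ex 1.1 (ii) p.8] -/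
def logq (A : Dᵒᵖ) : (datum E hloc hc he hq').Φ.obj A := ⟨Monogenic.gen base (E.img q') A.unop, Submonoid.mem_powers _⟩

/-- `Φ_{C_v^⊢}(A)` is free on `log(q′)` ("a sub-monoid … isomorphic to `ℕ`"). [cite: MochizukiFrdII2008, Ex 1.1 (ii) p.8] -/
theorem logq_generates (A : Dᵒᵖ) (x : (datum E hloc hc he hq').Φ.obj A) : ∃! n : ℕ, x = logq E hloc hc he hq' A ^ n := by
  obtain ⟨y, n, rfl⟩ := x
  refine ⟨n, Subtype.ext rfl, fun m hm => ?_⟩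
  have h : Monogenic.gen base (E.img q') A.unop ^ n = Monogenic.gen base (E.img q') A.unop ^ m :=
    congrArg Subtype.val hm
  exact (Monogenic.gen_pow_injective base (E.isConstantSection hq') (hloc A.unop) h).symm

/-- "`Φ`, `B` are monoids on `D`" for `C_v^⊢` over a base of FSM-type. [cite: MochizukiFrdII2008, Ex 1.1 (ii) p.8] -/
theorem isMonoidData (hD : IsOfFSMType D) : (datum E hloc hc he hq').IsMonoidData :=
  Datum.monogenic_isMonoidData base (E.isConstantSection hq') hloc hc he hD

/-- For an associate `q″` of `q′`, the images of `q″` (restricted to `K^×`) form a splitting family of the `q′`-datum: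
compatible, of valuation `< 1`, and `Div₀(q″_A) = Div₀(q′_A)` generates `ι(Φ)`. [cite: MochizukiFrdII2008, Thm 1.2 (v) p.10] -/
theorem isSplittingFamily_of_associated {q'' : intNonzero Kv} (h : Associated q'' q') :
    (datum E hloc hc he hq').IsSplittingFamily fun A => intNonzeroToUnits (base.obj A).K (E.img q'' A) := by
  have hq'' : ¬ IsUnit q'' := fun hu => hq' (h.isUnit hu)
  have hcs'' := E.isConstantSection hq''
  refine ⟨fun f => hcs''.units_map_eq base f, fun A => hcs''.valuation_lt_one base A, fun A z => ?_⟩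
  obtain ⟨k, hk⟩ := Datum.monogenic_generates base (E.isConstantSection hq') hloc hc he A z
  have e1 : divZeroHom (base.obj A).K (intNonzeroToUnits (base.obj A).K (E.img q'' A)) =
      divZeroHom (base.obj A).K (intNonzeroToUnits (base.obj A).K (E.img q' A)) := by
    rw [divZeroHom_intNonzeroToUnits, divZeroHom_intNonzeroToUnits, E.associatesMk_img_eq h]
  exact ⟨k, hk.trans (congrArg (· ^ k) e1.symm)⟩

/-- **`τ(q″)`: the characteristic splitting on `C_v^⊢(q′)` determined by an associate `q″` of `q′`** — for `q′ = q̲_v` a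
`2l`-th root of `q_v`, the other `2l`-th roots are its associates and these are the members of the printed
"`μ_{2l}(−)`-orbit of characteristic splittings `τ_v^⊢`" ([FrdI] Def. 2.3 via abc-iut-L1-t4's `Datum.cSplitting`).
[cite: MochizukiFrdII2008, Thm 1.2 (v) p.10] -/
def tauDashOf (q'' : intNonzero Kv) (h : Associated q'' q') :
    PreFrobenioid.CharacteristicSplitting (datum E hloc hc he hq').structureFunctor :=
  (datum E hloc hc he hq').cSplitting (isSplittingFamily_of_associated E hloc hc he hq' h)

/-- `τ_v^⊢ := τ(q′)` itself. [cite: MochizukiFrdII2008, Thm 1.2 (v) p.10] -/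
def tauDash : PreFrobenioid.CharacteristicSplitting (datum E hloc hc he hq').structureFunctor :=
  tauDashOf E hloc hc he hq' q' (Associated.refl q')

/-- The `τ`-component of `τ(q″)`: base-identity linear endomorphisms whose rational function restricted to `K_A^×` is a
power of `q″_A`. [cite: MochizukiFrdII2008, Thm 1.2 (v) p.10] -/
@[simp] theorem tauDashOf_τ (q'' : intNonzero Kv) (h : Associated q'' q') :
    (tauDashOf E hloc hc he hq' q'' h).τ =
      (datum E hloc hc he hq').cSplittingSubmonoid fun A => intNonzeroToUnits (base.obj A).K (E.img q'' A) := rfl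

/-! ### `C_v^⊢` inside the `p_v`-adic Frobenioid of the perfection (same base) -/

/-- The `q′`-datum as a `SubDatum` (`= datum` definitionally). [cite: MochizukiFrdII2008, Ex 1.1 (ii) p.8] -/
def monogenicSubDatum : SubDatum base where
  S A := Submonoid.powers (Monogenic.gen base (E.img q') A)
  map_mem f x hx := by
    obtain ⟨n, rfl⟩ := hx
    exact ⟨n, by rw [map_pow, Monogenic.phi0Map_gen base (E.isConstantSection hq')]⟩
  isMonoprime A := by
    classical
    exact IsMonoprime.ofZ ⟨⟨(Submonoid.powLogEquiv
      (Monogenic.gen_pow_injective base (E.isConstantSection hq') (hloc A))).symm⟩⟩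
  g A := E.img q' A
  g_mem A := Submonoid.mem_powers _
  g_not_isUnit A := E.not_isUnit_img hq' A

/-- Its datum IS the monogenic datum (definitionally). [cite: MochizukiFrdII2008, Ex 1.1 (ii) p.8] -/
theorem monogenicSubDatum_toDatum :
    (monogenicSubDatum E hloc hq').toDatum hloc hc he = datum E hloc hc he hq' := rfl

/-- `ℕ · log(q′) ⊆ ord(O^⊳)^pf` objectwise. [cite: MochizukiFrdII2008, Ex 1.1 (ii) p.8] -/
theorem monogenicSubDatum_le_perfSubDatum (A : D) : (monogenicSubDatum E hloc hq').S A ≤ (perfSubDatum base hloc).S A :=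
  (Submonoid.powers_le).mpr (Realification.of_mem_perf _)

/-- **`C_v^⊢ →` the `p_v`-adic Frobenioid of the perfection `ord(O^⊳)^pf`** over the same base (inclusion of data;
faithful). [cite: MochizukiFrdII2008, Ex 1.1 (ii) p.8] -/
def CdashToPerf : Cdash E hloc hc he hq' ⥤ (Datum.perf base hloc hc he).frobenioid :=
  (monogenicSubDatum E hloc hq').inclusionFunctor (perfSubDatum base hloc) (monogenicSubDatum_le_perfSubDatum E hloc hq')
    hloc hc he

/-- `C_v^⊢ → C^pf` is faithful. [cite: MochizukiFrdII2008, Ex 1.1 (ii) p.8] -/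
theorem CdashToPerf_faithful : (CdashToPerf E hloc hc he hq').Faithful :=
  (monogenicSubDatum E hloc hq').inclusionFunctor_faithful (perfSubDatum base hloc)
    (monogenicSubDatum_le_perfSubDatum E hloc hq') hloc hc he

end BadLocalKit

end PadicFrd

end Literature.AlgebraicGeometry.Frobenioids
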